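import Literature.Probability.RandomPlanarGeometry.SLESixHullLocalityAlive
import Literature.Probability.RandomPlanarGeometry.SLEImageBM
import HarnessLib

/-!
# Locality of chordal SLE₆ with respect to a bounded hull, half-plane ALIVE form: proved

Topic `Probability/RandomPlanarGeometry`; one theorem (crux `stmt-CriticalPhenomena-0698`, stub
`stub_isLocal`). The named fact `sle_six_hull_locality_alive` (`SLESixHullLocalityFact.lean`;
Lawler–Schramm–Werner, Acta Math. 187 (2001) Thm. 2.2 / JAMS 16 (2003) §5: the conformal image
`E_A ∘ γ` of the SLE₆ trace, observed until a stopping set is hit while the closed hull still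
misses the `*`-hull `A`, has the law of an SLE₆ trace observed until the image stopping set) is
DISCHARGED: the assembly `sle_six_hull_locality_alive_of_imageBM` (`SLESixHullLocalityAlive.lean`:
trace identification through the image chain, dictionary of first hits, law identity at every
localisation level with vanishing error) fed with the image Brownian motion of the worker chain
(`SLEImageBM.lean`: `exists_sle_image_brownian` — image driving value `W̃ = W + L_A − L_{B_t}`,
zero drift at `κ = 6`, bracket `6 ∫ d²`, Dambis–Dubins–Schwarz and concatenation —, and the
exhaustion `eventually_lt_imgLocTimeK`).
-/

noncomputable section

namespace Literature.Probability.RandomPlanarGeometry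

/-- **Locality of chordal SLE₆ with respect to a bounded hull, half-plane alive form, holds**
(Lawler–Schramm–Werner 2001, Thm. 2.2; 2003, §5). [cite: LawlerSchrammWerner2001, Thm 2.2] -/
theorem sle_six_hull_locality_alive_holds : sle_six_hull_locality_alive :=
  sle_six_hull_locality_alive_of_imageBM (fun hA hne n ↦ exists_sle_image_brownian hA hne n)
    (fun hA hne _ _ h ↦ eventually_lt_imgLocTimeK hA hne h)

end Literature.Probability.RandomPlanarGeometry

end
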